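import Mathlib
import HarnessLib
import Summits.HubbardSuperconductivity.HubbardSuperconductivity.Theorems.KLProgrammeKLRegimeSplitTwoLegSizesMSChainStep

/-!
# Route `KLProgramme`, crux K3 — (E3a-MS) supplier, DEPTH-GRADED chain budgets (repair MS-A34 (R-a)/(R-b); k3c3-p1 g4)

Seat hubbard-kl-k3c3-p1 (g4).  The landed chain bookkeeping (`chainSizeSum`, `…MSChainCurves`; `chain_regime_of_pieces`, `…MSOfPieces`) charges EVERY
chain frame `msChain d Kp n N k` with the order-3/4 sizes of the FULL frame (high parts summed over all of `Ioc n N`, low parts in CONTRACTION form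
`3·anchorSize`), so the term table's `msD A₃ A₄` / `msdD A A₃ A₄ …` carry `A₃ ≍ Gfr₃U²4^{N}`, `A₄ ≍ Gfr₄U²16^{N}` at every slot and at the base —
and the fits of `twoLegSizesMST_succ_of_pieces` / `_zero_of_pieces` become unsatisfiable below the top scales (k3c3-p3 g4 MS-A34, evidence #42 on
stmt-…-19918; found independently here).  The analytic lemmas are fine; only the budgets were summed too coarsely.  This file grades them by DEPTH:

* `lowSize d a j := min (3·anchorSize a j) (24(2d+1)(1+4d)ʲ·a 0)` — the better of the contraction and the BERNSTEIN form of the low part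
  (`norm_iteratedFDeriv_evalM_lowPart_le` / `_le_bernstein`, `…MSPieceParts`): `norm_iteratedFDeriv_evalM_lowPart_le_lowSize`;
* `chainSizeSumG d Kp a n N k j` — coarse pieces + constant + low parts (`lowSize`) of ALL deep pieces + high parts of the slots `≤ n + k` ONLY
  (exactly what `norm_iteratedFDeriv_frameShift_msChain_le` gives per `k`): `norm_iteratedFDeriv_frameShift_msChain_le_sumG`, monotone in `k`
  (`chainSizeSumG_mono`), below the uniform sum (`chainSizeSumG_le_chainSizeSum`);
* `chain_curve_sizes_graded` — frame `k`'s Fermi curve is `C⁴` with tower `klCurveD1, klCurveD2, klCurveD3 (A₃), klCurveD4 (A₃) (A₄)` for ANY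
  `A₃ ≥ chainSizeSumG … k 3`, `A₄ ≥ chainSizeSumG … k 4` (orders `≤ 2` keep one uniform `A`, which is `O(c)` and harmless);
* `step_curve_diff_of_frames` — the ONE-STEP curve-difference estimate of `…MSChainStep` for two ARBITRARY frames `K' = K ⊕ P` on values, frame-keyed
  (sizes `A; A₃, A₄` of both frames, sizes `e` of `P`): `‖γ_{K'} − γ_K‖ ≤ msdD A A₃ A₄ Dt e 0`, `‖γ_{K'}⁽ⁱ⁾ − γ_K⁽ⁱ⁾‖ ≤ msdD … e i`;
* `chain_step_curve_diff_graded` — its instance on the chain frames `k − 1`, `k` with the DEPTH-`k` budgets `A₃ ≥ chainSizeSumG … k 3`, `A₄ ≥ … k 4`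
  (frame `k − 1` is covered by monotonicity).

The graded term table and the graded suppliers follow in `…MSChainTableGraded` / `…MSWithPiecesGraded`.  Proofs only; nothing about the model.
-/

noncomputable section

namespace Summit.HubbardSuperconductivity.HubbardSuperconductivity.Theorems.KLRegimeSplit

set_option linter.dupNamespace false -- summit = problem name (single-conjunct summit), D-0017
set_option maxSynthPendingDepth 4 -- nested operator-norm instances (up to fourth Fréchet derivatives and their sums), as in `…CompDiff`

open Real Finset Literature.MathematicalPhysics.QuantumLattice Literature.MathematicalPhysics.QuantumLattice.BandSectorCounting
open Summit.HubbardSuperconductivity.HubbardSuperconductivity.Theorems.DispersionFlow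
open Summit.HubbardSuperconductivity.HubbardSuperconductivity.Theorems.PerturbedFermiCurve

/-! ## §1 Graded sizes: low parts in the better form, high parts by depth -/

/-- **The low-part size**: the better of the contraction form `3·anchorSize a j` and the Bernstein form `24(2d+1)(1+4d)ʲ·a 0`. -/
def lowSize (d : ℕ) (a : ℕ → ℝ) (j : ℕ) : ℝ := min (3 * anchorSize a j) (24 * (2 * d + 1) * (1 + 4 * d) ^ j * a 0)

/-- **Sizes of the low part, graded form**: `‖Dʲ evalM (lowPart d P)‖ ≤ lowSize d a j` (`j ≤ 4`). -/
theorem norm_iteratedFDeriv_evalM_lowPart_le_lowSize {d : ℕ} {P : TrigPolyC4v} {a : ℕ → ℝ}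
    (ha : ∀ j ≤ 4, ∀ q : Momentum, ‖iteratedFDeriv ℝ j (evalM P) q‖ ≤ a j) {j : ℕ} (hj : j ≤ 4) (q : Momentum) :
    ‖iteratedFDeriv ℝ j (evalM (lowPart d P)) q‖ ≤ lowSize d a j :=
  le_min (norm_iteratedFDeriv_evalM_lowPart_le d ha hj q) (norm_iteratedFDeriv_evalM_lowPart_le_bernstein d (ha 0 (Nat.zero_le _)) j q)

/-- `lowSize ≤ 3·anchorSize` (the contraction form). -/
theorem lowSize_le_contraction (d : ℕ) (a : ℕ → ℝ) (j : ℕ) : lowSize d a j ≤ 3 * anchorSize a j := min_le_left _ _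

/-- `lowSize ≤ 24(2d+1)(1+4d)ʲ·a 0` (the Bernstein form). -/
theorem lowSize_le_bernstein (d : ℕ) (a : ℕ → ℝ) (j : ℕ) : lowSize d a j ≤ 24 * (2 * d + 1) * (1 + 4 * d) ^ j * a 0 := min_le_right _ _

/-- `lowSize` is nonnegative for nonnegative sizes. -/
theorem lowSize_nonneg (d : ℕ) {a : ℕ → ℝ} (ha : ∀ j, 0 ≤ a j) (j : ℕ) : 0 ≤ lowSize d a j := by
  have h0 := ha 0; have hj := ha j
  have h1 : 0 ≤ anchorSize a j := by unfold anchorSize; split_ifs <;> positivity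
  unfold lowSize
  exact le_min (by positivity) (by positivity)

/-- **The DEPTH-GRADED chain size sum** of frame `k`: coarse pieces + constant + low parts (graded form) of all deep pieces + high parts of the
slots `n+1 … n+k` only. -/
def chainSizeSumG (d : ℕ) (Kp : ℕ → TrigPolyC4v) (a : ℕ → ℕ → ℝ) (n N k j : ℕ) : ℝ :=
  ∑ m ∈ range (n + 1), a m j + (if j = 0 then |∑ m ∈ Ioc n N, (Kp m).eval 0| else 0) +
    ∑ m ∈ Ioc n N, lowSize d (a m) j + ∑ m ∈ Ioc n (n + k), 4 * anchorSize (a m) j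

section Chain

variable (d : ℕ) {Kp : ℕ → TrigPolyC4v} {n N : ℕ} (hnN : n ≤ N) {a : ℕ → ℕ → ℝ}
  (ha : ∀ m ≤ N, ∀ j ≤ 4, ∀ q : Momentum, ‖iteratedFDeriv ℝ j (evalM (Kp m)) q‖ ≤ a m j)

include hnN ha in
/-- **Frame `k`'s `frameShift` is bounded by the depth-`k` graded sum** (`j ≤ 4`, `k ≤ N − n`). -/
theorem norm_iteratedFDeriv_frameShift_msChain_le_sumG {k : ℕ} (hk : k ≤ N - n) {j : ℕ} (hj : j ≤ 4) (q : Momentum) :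
    ‖iteratedFDeriv ℝ j (frameShift (msChain d Kp n N k)) q‖ ≤ chainSizeSumG d Kp a n N k j := by
  have h := norm_iteratedFDeriv_frameShift_msChain_le d Kp hnN k j q
  have h1 : ∑ m ∈ range (n + 1), ‖iteratedFDeriv ℝ j (evalM (Kp m)) q‖ ≤ ∑ m ∈ range (n + 1), a m j :=
    Finset.sum_le_sum fun m hm => ha m (by have := mem_range.mp hm; omega) j hj q
  have h2 : ∑ m ∈ Ioc n N, ‖iteratedFDeriv ℝ j (evalM (lowPart d (Kp m))) q‖ ≤ ∑ m ∈ Ioc n N, lowSize d (a m) j :=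
    Finset.sum_le_sum fun m hm => norm_iteratedFDeriv_evalM_lowPart_le_lowSize (ha m (Finset.mem_Ioc.mp hm).2) hj q
  have h3 : ∑ m ∈ Ioc n (n + k), ‖iteratedFDeriv ℝ j (evalM (highPart d (Kp m))) q‖ ≤ ∑ m ∈ Ioc n (n + k), 4 * anchorSize (a m) j :=
    Finset.sum_le_sum fun m hm =>
      (norm_iteratedFDeriv_evalM_highPart_le d (ha m (by have := Finset.mem_Ioc.mp hm; omega))).1 j hj q
  unfold chainSizeSumG
  linarith

/-- **The graded sum is monotone in the depth** (nonnegative sizes). -/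
theorem chainSizeSumG_mono (hann : ∀ m j, 0 ≤ a m j) {k k' : ℕ} (hkk : k ≤ k') (j : ℕ) :
    chainSizeSumG d Kp a n N k j ≤ chainSizeSumG d Kp a n N k' j := by
  have hsub : Ioc n (n + k) ⊆ Ioc n (n + k') := fun m hm => by rw [Finset.mem_Ioc] at hm ⊢; omega
  have h : ∑ m ∈ Ioc n (n + k), 4 * anchorSize (a m) j ≤ ∑ m ∈ Ioc n (n + k'), 4 * anchorSize (a m) j :=
    Finset.sum_le_sum_of_subset_of_nonneg hsub fun m _ _ => by
      have : 0 ≤ anchorSize (a m) j := by unfold anchorSize; split_ifs <;> (have := hann m 0; have := hann m j; positivity)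
      positivity
  unfold chainSizeSumG
  linarith

include hnN in
/-- **The graded sum is below the uniform sum** of `…MSChainCurves` (nonnegative sizes, `k ≤ N − n`). -/
theorem chainSizeSumG_le_chainSizeSum (hann : ∀ m j, 0 ≤ a m j) {k : ℕ} (hk : k ≤ N - n) (j : ℕ) :
    chainSizeSumG d Kp a n N k j ≤ chainSizeSum Kp a n N j := by
  have hsub : Ioc n (n + k) ⊆ Ioc n N := fun m hm => by rw [Finset.mem_Ioc] at hm ⊢; omega
  have hanc : ∀ m, 0 ≤ anchorSize (a m) j := fun m => by
    unfold anchorSize; split_ifs <;> (have := hann m 0; have := hann m j; positivity)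
  have h1 : ∑ m ∈ Ioc n N, lowSize d (a m) j ≤ ∑ m ∈ Ioc n N, 3 * anchorSize (a m) j :=
    Finset.sum_le_sum fun m _ => lowSize_le_contraction d (a m) j
  have h2 : ∑ m ∈ Ioc n (n + k), 4 * anchorSize (a m) j ≤ ∑ m ∈ Ioc n N, 4 * anchorSize (a m) j :=
    Finset.sum_le_sum_of_subset_of_nonneg hsub fun m _ _ => by have := hanc m; positivity
  unfold chainSizeSumG chainSizeSum
  linarith

include hnN ha in
/-- **THE CHAIN FRAMES' CURVES, depth-graded.**  With the uniform `C²` budget `A` (`j ≤ 2`, over the deepest frame `k₀ ≥ k`), `A ≤ 1/20`,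
`klCurveD ≤ Dt_min − 2A`, the window margins, and DEPTH-`k` budgets `A₃ ≥ chainSizeSumG … k 3`, `A₄ ≥ chainSizeSumG … k 4`: the Fermi-point map of
`msChain d Kp n N k` at level `μ` is `C⁴` with the tower `klCurveD1, klCurveD2, klCurveD3 A₃, klCurveD4 A₃ A₄`. -/
theorem chain_curve_sizes_graded (hann : ∀ m j, 0 ≤ a m j) {k₀ : ℕ} (hk₀ : k₀ ≤ N - n)
    {A : ℝ} (hA : ∀ j ≤ 2, chainSizeSumG d Kp a n N k₀ j ≤ A) (hA20 : A ≤ 1 / 20)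
    (hd : klCurveD ≤ (bandBounds (show (-4 : ℝ) < -1.1 by norm_num) (show (-1.1 : ℝ) ≤ -0.1 by norm_num)
      (show (-0.1 : ℝ) < 0 by norm_num)).Dtmin - 2 * A)
    {μ : ℝ} (hlo : (-1.1 : ℝ) ≤ μ - A) (hhi : μ + A ≤ -0.1)
    {k : ℕ} (hk : k ≤ k₀) {A₃ A₄ : ℝ} (hA₃ : chainSizeSumG d Kp a n N k 3 ≤ A₃) (hA₄ : chainSizeSumG d Kp a n N k 4 ≤ A₄) (θ : ℝ) :
    ContDiff ℝ 4 (fun θ : ℝ => (WithLp.toLp 2 (klFermiPoint μ (msChain d Kp n N k) θ) : Momentum)) ∧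
    ContDiff ℝ 4 (klFermiPoint μ (msChain d Kp n N k)) ∧
    ‖iteratedFDeriv ℝ 1 (fun θ : ℝ => (WithLp.toLp 2 (klFermiPoint μ (msChain d Kp n N k) θ) : Momentum)) θ‖ ≤ klCurveD1 ∧
    ‖iteratedFDeriv ℝ 2 (fun θ : ℝ => (WithLp.toLp 2 (klFermiPoint μ (msChain d Kp n N k) θ) : Momentum)) θ‖ ≤ klCurveD2 ∧
    ‖iteratedFDeriv ℝ 3 (fun θ : ℝ => (WithLp.toLp 2 (klFermiPoint μ (msChain d Kp n N k) θ) : Momentum)) θ‖ ≤ klCurveD3 A₃ ∧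
    ‖iteratedFDeriv ℝ 4 (fun θ : ℝ => (WithLp.toLp 2 (klFermiPoint μ (msChain d Kp n N k) θ) : Momentum)) θ‖ ≤ klCurveD4 A₃ A₄ := by
  have hkN : k ≤ N - n := hk.trans hk₀
  have hAj : ∀ p : Momentum, ∀ j ≤ 2, ‖iteratedFDeriv ℝ j (frameShift (msChain d Kp n N k)) p‖ ≤ A := fun p j hj =>
    ((norm_iteratedFDeriv_frameShift_msChain_le_sumG d hnN ha hkN (by omega) p).trans (chainSizeSumG_mono d hann hk j)).trans (hA j hj)
  have h3 : ∀ p : Momentum, ‖iteratedFDeriv ℝ 3 (frameShift (msChain d Kp n N k)) p‖ ≤ A₃ := fun p =>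
    (norm_iteratedFDeriv_frameShift_msChain_le_sumG d hnN ha hkN (by norm_num) p).trans hA₃
  have h4 : ∀ p : Momentum, ‖iteratedFDeriv ℝ 4 (frameShift (msChain d Kp n N k)) p‖ ≤ A₄ := fun p =>
    (norm_iteratedFDeriv_frameShift_msChain_le_sumG d hnN ha hkN le_rfl p).trans hA₄
  obtain ⟨hC, hD1, hD2, hD3, hD4⟩ := fermiPointLp_sizes_of_sizes hAj hA20 hd hlo hhi h3 h4 θ
  exact ⟨hC, contDiff_of_contDiff_toLp hC, hD1, hD2, hD3, hD4⟩

end Chain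

/-! ## §2 One step between two arbitrary frames `K' = K ⊕ P` (frame-keyed form of `chain_step_curve_diff`) -/

section Step

/-- **ONE STEP, FRAME-KEYED (P2-INTERFACE §§2–3 instantiated for arbitrary frames).**  Two frames `K, K'` with `K' = K + P` on values, both within
the `C²` budget `A` (`A ≤ 1/20`, `klCurveD ≤ Dt_min − 2A`, window margins at `μ`) and with third/fourth sizes `≤ A₃, A₄`; `P` with sizes `e j`
(`j ≤ 4`).  Then the Fermi curves differ by `≤ msdD A A₃ A₄ Dt_min e 0` and their `i`-th derivatives by `≤ msdD … e i` (`1 ≤ i ≤ 4`). -/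
theorem step_curve_diff_of_frames {K K' P : TrigPolyC4v} (hstep : ∀ p : Fin 2 → ℝ, K'.eval p = K.eval p + P.eval p)
    {A : ℝ} (hAK : ∀ p : Momentum, ∀ j ≤ 2, ‖iteratedFDeriv ℝ j (frameShift K) p‖ ≤ A)
    (hAK' : ∀ p : Momentum, ∀ j ≤ 2, ‖iteratedFDeriv ℝ j (frameShift K') p‖ ≤ A) (hA20 : A ≤ 1 / 20)
    (hd : klCurveD ≤ (bandBounds (show (-4 : ℝ) < -1.1 by norm_num) (show (-1.1 : ℝ) ≤ -0.1 by norm_num)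
      (show (-0.1 : ℝ) < 0 by norm_num)).Dtmin - 2 * A)
    {μ : ℝ} (hlo : (-1.1 : ℝ) ≤ μ - A) (hhi : μ + A ≤ -0.1)
    {A₃ A₄ : ℝ} (h3K : ∀ p : Momentum, ‖iteratedFDeriv ℝ 3 (frameShift K) p‖ ≤ A₃)
    (h4K : ∀ p : Momentum, ‖iteratedFDeriv ℝ 4 (frameShift K) p‖ ≤ A₄)
    (h3K' : ∀ p : Momentum, ‖iteratedFDeriv ℝ 3 (frameShift K') p‖ ≤ A₃)
    (h4K' : ∀ p : Momentum, ‖iteratedFDeriv ℝ 4 (frameShift K') p‖ ≤ A₄)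
    {e : ℕ → ℝ} (he : ∀ j ≤ 4, ∀ q : Momentum, ‖iteratedFDeriv ℝ j (evalM P) q‖ ≤ e j) (θ : ℝ) :
    ‖(WithLp.toLp 2 (klFermiPoint μ K' θ) : Momentum) - WithLp.toLp 2 (klFermiPoint μ K θ)‖ ≤
      msdD A A₃ A₄ ((bandBounds (show (-4 : ℝ) < -1.1 by norm_num) (show (-1.1 : ℝ) ≤ -0.1 by norm_num)
        (show (-0.1 : ℝ) < 0 by norm_num)).Dtmin) e 0 ∧
    ∀ i, 1 ≤ i → i ≤ 4 →
      ‖iteratedDeriv i (fun θ : ℝ => (WithLp.toLp 2 (klFermiPoint μ K' θ) : Momentum)) θ -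
          iteratedDeriv i (fun θ : ℝ => (WithLp.toLp 2 (klFermiPoint μ K θ) : Momentum)) θ‖ ≤
        msdD A A₃ A₄ ((bandBounds (show (-4 : ℝ) < -1.1 by norm_num) (show (-1.1 : ℝ) ≤ -0.1 by norm_num)
          (show (-0.1 : ℝ) < 0 by norm_num)).Dtmin) e i := by
  set B := bandBounds (show (-4 : ℝ) < -1.1 by norm_num) (show (-1.1 : ℝ) ≤ -0.1 by norm_num) (show (-0.1 : ℝ) < 0 by norm_num)
    with hBdef
  have hADt : 2 * A < B.Dtmin := by have := klCurveD_pos; linarith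
  -- the step: `K' = K ⊕ P` on values
  have hstep' : (fun p : Fin 2 → ℝ => -K'.eval p) = fun p => (-K.eval p) + (-P.eval p) := by
    funext p; rw [hstep p]; ring
  have hcK : ContDiff ℝ 5 (fun p : Fin 2 → ℝ => -K.eval p) := by
    rw [← frameShift_toLp_eq_neg_eval]; exact (contDiff_frameShift K).comp (PiLp.contDiff_toLp (p := 2))
  have hcP : ContDiff ℝ 5 (fun p : Fin 2 → ℝ => -P.eval p) := by
    rw [← frameShift_toLp_eq_neg_eval]; exact (contDiff_frameShift P).comp (PiLp.contDiff_toLp (p := 2))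
  obtain ⟨n1, n2, n3, n4⟩ := nested_fderiv_add hcK hcP
  -- sizes of `P`, transported to `Fin 2 → ℝ`
  have heP : ∀ j ≤ 4, ∀ kk : Fin 2 → ℝ, ‖iteratedFDeriv ℝ j (fun p : Fin 2 → ℝ => -P.eval p) kk‖ ≤ e j * 2 ^ j := by
    intro j hj kk
    rw [← frameShift_toLp_eq_neg_eval]
    exact norm_iteratedFDeriv_frameShift_toLp_le_single (fun q => by rw [norm_iteratedFDeriv_frameShift_eq]; exact he j hj q) kk
  have hE₀ : ∀ kk : Fin 2 → ℝ, (∀ i, |kk i| ≤ π) →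
      |(fun p : Fin 2 → ℝ => -K'.eval p) kk - (fun p : Fin 2 → ℝ => -K.eval p) kk| ≤ e 0 := by
    intro kk _
    have h := heP 0 (by norm_num) kk
    rw [norm_iteratedFDeriv_zero, Real.norm_eq_abs, pow_zero, mul_one] at h
    rw [hstep']; simpa using h
  have hE₁ : ∀ kk : Fin 2 → ℝ, (∀ i, |kk i| ≤ π) →
      ‖fderiv ℝ (fun p : Fin 2 → ℝ => -K'.eval p) kk - fderiv ℝ (fun p : Fin 2 → ℝ => -K.eval p) kk‖ ≤ 2 * e 1 := by
    intro kk _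
    have h := heP 1 (by norm_num) kk
    rw [← norm_fderiv_eq_norm_iteratedFDeriv_one] at h
    rw [hstep', n1]; dsimp only; rw [add_sub_cancel_left]; linarith
  have hE₂ : ∀ kk : Fin 2 → ℝ, (∀ i, |kk i| ≤ π) →
      ‖fderiv ℝ (fderiv ℝ (fun p : Fin 2 → ℝ => -K'.eval p)) kk - fderiv ℝ (fderiv ℝ (fun p : Fin 2 → ℝ => -K.eval p)) kk‖ ≤
        4 * e 2 := by
    intro kk _
    have h := heP 2 (by norm_num) kk
    rw [← norm_fderiv_two_eq_norm_iteratedFDeriv] at h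
    rw [hstep', n2]; dsimp only; rw [add_sub_cancel_left]; linarith
  have hE₃ : ∀ kk : Fin 2 → ℝ, (∀ i, |kk i| ≤ π) →
      ‖fderiv ℝ (fderiv ℝ (fderiv ℝ (fun p : Fin 2 → ℝ => -K'.eval p))) kk -
        fderiv ℝ (fderiv ℝ (fderiv ℝ (fun p : Fin 2 → ℝ => -K.eval p))) kk‖ ≤ 8 * e 3 := by
    intro kk _
    have h := heP 3 (by norm_num) kk
    rw [← norm_fderiv_three_eq_norm_iteratedFDeriv] at h
    rw [hstep', n3]; dsimp only; rw [add_sub_cancel_left]; linarith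
  have hE₄ : ∀ kk : Fin 2 → ℝ, (∀ i, |kk i| ≤ π) →
      ‖fderiv ℝ (fderiv ℝ (fderiv ℝ (fderiv ℝ (fun p : Fin 2 → ℝ => -K'.eval p)))) kk -
        fderiv ℝ (fderiv ℝ (fderiv ℝ (fderiv ℝ (fun p : Fin 2 → ℝ => -K.eval p)))) kk‖ ≤ 16 * e 4 := by
    intro kk _
    have h := heP 4 (by norm_num) kk
    rw [← norm_fderiv_four_eq_norm_iteratedFDeriv] at h
    rw [hstep', n4]; dsimp only; rw [add_sub_cancel_left]; linarith
  -- radius towers of both frames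
  obtain ⟨-, r1, r2, r3, r4⟩ := frameRadius_tower_of_sizes hAK hA20 hd hlo hhi h3K h4K θ
  obtain ⟨-, r1', r2', r3', -⟩ := frameRadius_tower_of_sizes hAK' hA20 hd hlo hhi h3K' h4K' θ
  -- the radius differences
  have hW₀ := abs_frameRadius_sub_le B hAK hAK' hADt hlo hhi hE₀ θ
  have hW₁ : |deriv (perturbedFermiRadius (fun p : Fin 2 → ℝ => -K'.eval p) μ) θ -
      deriv (perturbedFermiRadius (fun p : Fin 2 → ℝ => -K.eval p) μ) θ| ≤ msW1 A B.Dtmin e := by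
    unfold msW1; exact abs_deriv_frameRadius_sub_le B hAK hAK' hADt hlo hhi hE₀ hE₁ θ
  have hW₂ : |deriv (deriv (perturbedFermiRadius (fun p : Fin 2 → ℝ => -K'.eval p) μ)) θ -
      deriv (deriv (perturbedFermiRadius (fun p : Fin 2 → ℝ => -K.eval p) μ)) θ| ≤ msW2 A A₃ B.Dtmin e := by
    unfold msW2
    exact (abs_deriv_tower_frameRadius_sub_le B hAK hAK' hADt hlo hhi hE₀ h3K h4K hE₁ hE₂ hE₃ hE₄ r1 r1' r2 r2' r3 r3' r4 hW₁
      le_rfl le_rfl).1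
  have hW₃ : |deriv (deriv (deriv (perturbedFermiRadius (fun p : Fin 2 → ℝ => -K'.eval p) μ))) θ -
      deriv (deriv (deriv (perturbedFermiRadius (fun p : Fin 2 → ℝ => -K.eval p) μ))) θ| ≤ msW3 A A₃ A₄ B.Dtmin e := by
    unfold msW3
    exact (abs_deriv_tower_frameRadius_sub_le B hAK hAK' hADt hlo hhi hE₀ h3K h4K hE₁ hE₂ hE₃ hE₄ r1 r1' r2 r2' r3 r3' r4 hW₁
      hW₂ le_rfl).2.1
  have hW₄ : |deriv (deriv (deriv (deriv (perturbedFermiRadius (fun p : Fin 2 → ℝ => -K'.eval p) μ)))) θ -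
      deriv (deriv (deriv (deriv (perturbedFermiRadius (fun p : Fin 2 → ℝ => -K.eval p) μ)))) θ| ≤ msW4 A A₃ A₄ B.Dtmin e := by
    unfold msW4
    exact (abs_deriv_tower_frameRadius_sub_le B hAK hAK' hADt hlo hhi hE₀ h3K h4K hE₁ hE₂ hE₃ hE₄ r1 r1' r2 r2' r3 r3' r4 hW₁
      hW₂ hW₃).2.2
  -- the curve differences
  obtain ⟨c1, c2, c3, c4⟩ := norm_iteratedFDeriv_fermiPointLp_sub_le_four_orders B hAK hAK' hADt hlo hhi hW₀ hW₁ hW₂ hW₃ hW₄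
  -- `iteratedDeriv` key
  have hC : ContDiff ℝ 4 (fun θ : ℝ => (WithLp.toLp 2 (klFermiPoint μ K θ) : Momentum)) :=
    (fermiPointLp_sizes_of_sizes hAK hA20 hd hlo hhi h3K h4K θ).1
  have hC' : ContDiff ℝ 4 (fun θ : ℝ => (WithLp.toLp 2 (klFermiPoint μ K' θ) : Momentum)) :=
    (fermiPointLp_sizes_of_sizes hAK' hA20 hd hlo hhi h3K' h4K' θ).1
  have key : ∀ i ≤ 4,
      ‖iteratedDeriv i (fun θ : ℝ => (WithLp.toLp 2 (klFermiPoint μ K' θ) : Momentum)) θ -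
          iteratedDeriv i (fun θ : ℝ => (WithLp.toLp 2 (klFermiPoint μ K θ) : Momentum)) θ‖ =
        ‖iteratedFDeriv ℝ i (fun θ : ℝ => (WithLp.toLp 2 (klFermiPoint μ K' θ) : Momentum)) θ -
          iteratedFDeriv ℝ i (fun θ : ℝ => (WithLp.toLp 2 (klFermiPoint μ K θ) : Momentum)) θ‖ := by
    intro i hi
    have h1 : ContDiffAt ℝ i (fun θ : ℝ => (WithLp.toLp 2 (klFermiPoint μ K' θ) : Momentum)) θ :=
      (hC'.of_le (by exact_mod_cast hi)).contDiffAt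
    have h2 : ContDiffAt ℝ i (fun θ : ℝ => (WithLp.toLp 2 (klFermiPoint μ K θ) : Momentum)) θ :=
      (hC.of_le (by exact_mod_cast hi)).contDiffAt
    rw [← iteratedDeriv_sub h1 h2, ← iteratedFDeriv_sub_apply h1 h2, norm_iteratedFDeriv_eq_norm_iteratedDeriv]
  refine ⟨?_, ?_⟩
  · rw [norm_toLp_klFermiPoint_sub]; simpa [msdD, msW0] using hW₀
  · intro i hi1 hi4
    rw [key i hi4]
    interval_cases i
    · simpa [msdD, msW0] using c1
    · simpa [msdD, msW0] using c2
    · simpa [msdD, msW0] using c3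
    · simpa [msdD, msW0] using c4

variable (d : ℕ) {Kp : ℕ → TrigPolyC4v} {n N : ℕ} (hnN : n ≤ N) {a : ℕ → ℕ → ℝ}
  (ha : ∀ m ≤ N, ∀ j ≤ 4, ∀ q : Momentum, ‖iteratedFDeriv ℝ j (evalM (Kp m)) q‖ ≤ a m j)

include hnN ha in
/-- **ONE CHAIN STEP, depth-graded.**  As `chain_step_curve_diff` (`…MSChainStep`), with the uniform `C²` budget `A` over the deepest frame `k₀` and
the DEPTH-`k` budgets `A₃ ≥ chainSizeSumG … k 3`, `A₄ ≥ chainSizeSumG … k 4` (they cover frame `k − 1` by monotonicity). -/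
theorem chain_step_curve_diff_graded (hann : ∀ m j, 0 ≤ a m j) {k₀ : ℕ} (hk₀ : k₀ ≤ N - n)
    {A : ℝ} (hA : ∀ j ≤ 2, chainSizeSumG d Kp a n N k₀ j ≤ A) (hA20 : A ≤ 1 / 20)
    (hd : klCurveD ≤ (bandBounds (show (-4 : ℝ) < -1.1 by norm_num) (show (-1.1 : ℝ) ≤ -0.1 by norm_num)
      (show (-0.1 : ℝ) < 0 by norm_num)).Dtmin - 2 * A)
    {μ : ℝ} (hlo : (-1.1 : ℝ) ≤ μ - A) (hhi : μ + A ≤ -0.1)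
    {k : ℕ} (hk1 : 1 ≤ k) (hk : k ≤ k₀)
    {A₃ A₄ : ℝ} (hA₃ : chainSizeSumG d Kp a n N k 3 ≤ A₃) (hA₄ : chainSizeSumG d Kp a n N k 4 ≤ A₄)
    {e : ℕ → ℝ} (he : ∀ j ≤ 4, ∀ q : Momentum, ‖iteratedFDeriv ℝ j (evalM (highPart d (Kp (n + k)))) q‖ ≤ e j) (θ : ℝ) :
    ‖(WithLp.toLp 2 (klFermiPoint μ (msChain d Kp n N k) θ) : Momentum) - WithLp.toLp 2 (klFermiPoint μ (msChain d Kp n N (k - 1)) θ)‖ ≤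
      msdD A A₃ A₄ ((bandBounds (show (-4 : ℝ) < -1.1 by norm_num) (show (-1.1 : ℝ) ≤ -0.1 by norm_num)
        (show (-0.1 : ℝ) < 0 by norm_num)).Dtmin) e 0 ∧
    ∀ i, 1 ≤ i → i ≤ 4 →
      ‖iteratedDeriv i (fun θ : ℝ => (WithLp.toLp 2 (klFermiPoint μ (msChain d Kp n N k) θ) : Momentum)) θ -
          iteratedDeriv i (fun θ : ℝ => (WithLp.toLp 2 (klFermiPoint μ (msChain d Kp n N (k - 1)) θ) : Momentum)) θ‖ ≤
        msdD A A₃ A₄ ((bandBounds (show (-4 : ℝ) < -1.1 by norm_num) (show (-1.1 : ℝ) ≤ -0.1 by norm_num)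
          (show (-0.1 : ℝ) < 0 by norm_num)).Dtmin) e i := by
  have hkN : k ≤ N - n := hk.trans hk₀
  have hk' : k - 1 ≤ N - n := by omega
  -- frame sizes of both chain frames (frame `k-1` by monotonicity of the graded sums)
  have bound : ∀ k', k' ≤ k → ∀ j, j ≤ 4 → ∀ p : Momentum,
      ‖iteratedFDeriv ℝ j (frameShift (msChain d Kp n N k')) p‖ ≤ chainSizeSumG d Kp a n N k j := fun k' hk'k j hj p =>
    (norm_iteratedFDeriv_frameShift_msChain_le_sumG d hnN ha (hk'k.trans hkN) hj p).trans (chainSizeSumG_mono d hann hk'k _)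
  have hAK : ∀ p : Momentum, ∀ j ≤ 2, ‖iteratedFDeriv ℝ j (frameShift (msChain d Kp n N (k - 1))) p‖ ≤ A := fun p j hj =>
    ((bound (k - 1) (Nat.sub_le k 1) j (by omega) p).trans (chainSizeSumG_mono d hann hk j)).trans (hA j hj)
  have hAK' : ∀ p : Momentum, ∀ j ≤ 2, ‖iteratedFDeriv ℝ j (frameShift (msChain d Kp n N k)) p‖ ≤ A := fun p j hj =>
    ((bound k le_rfl j (by omega) p).trans (chainSizeSumG_mono d hann hk j)).trans (hA j hj)
  have h3K : ∀ p : Momentum, ‖iteratedFDeriv ℝ 3 (frameShift (msChain d Kp n N (k - 1))) p‖ ≤ A₃ := fun p =>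
    (bound (k - 1) (Nat.sub_le k 1) 3 (by norm_num) p).trans hA₃
  have h4K : ∀ p : Momentum, ‖iteratedFDeriv ℝ 4 (frameShift (msChain d Kp n N (k - 1))) p‖ ≤ A₄ := fun p =>
    (bound (k - 1) (Nat.sub_le k 1) 4 le_rfl p).trans hA₄
  have h3K' : ∀ p : Momentum, ‖iteratedFDeriv ℝ 3 (frameShift (msChain d Kp n N k)) p‖ ≤ A₃ := fun p =>
    (bound k le_rfl 3 (by norm_num) p).trans hA₃
  have h4K' : ∀ p : Momentum, ‖iteratedFDeriv ℝ 4 (frameShift (msChain d Kp n N k)) p‖ ≤ A₄ := fun p =>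
    (bound k le_rfl 4 le_rfl p).trans hA₄
  -- the step: frame `k` = frame `k-1` ⊕ the high part of piece `n+k` on values
  have hstep : ∀ p : Fin 2 → ℝ, (msChain d Kp n N k).eval p = (msChain d Kp n N (k - 1)).eval p + (highPart d (Kp (n + k))).eval p := by
    intro p
    rw [show k = (k - 1) + 1 by omega, eval_msChain_succ, show n + (k - 1) + 1 = n + (k - 1 + 1) by omega]
    simp only [Nat.add_sub_cancel]
  exact step_curve_diff_of_frames hstep hAK hAK' hA20 hd hlo hhi h3K h4K h3K' h4K' he θ

end Step

end Summit.HubbardSuperconductivity.HubbardSuperconductivity.Theorems.KLRegimeSplit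

end
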